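import Summits.BirchSwinnertonDyer.Rank1Residual.JET.CarrierReadingRecordsKitThree
import Summits.BirchSwinnertonDyer.BirchSwinnertonDyer.Theorems.Rank1ResidualJetCarrierAddKit
import Summits.BirchSwinnertonDyer.BirchSwinnertonDyer.Theorems.Rank1ResidualJetCarrierShaKernelSwap
import HarnessLib

/-!
# T1 JET (cell `bsd-jet`): the `p = 3` register ROW KITS re-keyed to NAMED PRINT ONLY — road F (bucket A,
# any reduction at 3), bucket B multiplicative at 3, and bucket B ADDITIVE at 3 (the cell where Jetchev's print
# has no hypothesis line at all) — `hJ`, `hMcU`, McCallum 5.2, `hrec`, `hD36`, `hlev` FED BY NAME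

HONEST FRAMING (programme file `BSD-LIT2PART-PROGRAMME-v1.md` §HONESTY, verbatim): «no tranche here
proves BSD; ARM L moves the LITERAL column of an r ≤ 1 census into the kernel-proved-modulo-named-print
column; ARM P changes what «named print» is worth.» THEOREMS ONLY (seat `bsd-jet-pv-2`, session g7;
`--supports stmt-BirchSwinnertonDyer-14418`, helper); nothing is booked by this file (bookings are referee
A's; the JET@p∣N rows of record stand on the documentary strikes R409/R466/R516–R518); 0 classes move.

WHAT. Sibling of `Rank1ResidualJetRecordsKitSwap` (roads S ∕ B5, p567356) for the three `p = 3` kits the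
landed by-name rows use: `bsdp_of_jetRowA3F_tam_min` (`JET/CarrierReadingRecordsKitThree` :77; bucket A,
ANY reduction at `3`, `ρ̄_{E,3}` onto from an irreducible Frobenius + a Frobenius of order `3`, the `3`-adic
tower from ONE mod-`9` Frobenius witness, carrier `q ≠ 3` by a `TamLocal` certificate),
`bsdp_of_jetRowB3_tam_min` (`JET/CarrierReadingRecordsKit` :345; bucket B, `3` MULTIPLICATIVE, carrier `3`) and
`bsdp_of_jetRowCarrierAdd_three_of_frobenius` (`Theorems/Rank1ResidualJetCarrierAddKit` :111; bucket B-add,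
`3` ADDITIVE of type IV/IV*, carrier `3` — K4, the reading with NO printed hypothesis line). Numeric front
ends VERBATIM; consumers replaced by the `…_level_…_of_swapLiterature` forms of
`Rank1ResidualJetCarrierShaKernelSwap` (p565138). Displayed class-free binders of all three twins: EXACTLY
{`hPT` (∀ K), `hF1`, `h372`, `hGZK`, `hKo` (∀), `hmod`} = Poitou–Tate for Selmer structures, [GZ86 III (3.1)] ∕
Gross §6, Gross 3.7 (2), GZK, Kolyvagin, modularity — NO reading binder, NO McCallum 5.2 ∕ Cor. 5.6, NO
Shimura ∕ Darmon ∕ Carayol binder. References: [cite: Jetchev2008, Thm. 1.4, Cor. 1.5 (p. 812)]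
[cite: Serre1972, §2.4 Prop. 15] [cite: SerreAbelianLadic1968, Ch. IV §3.4 Lemma 3] [cite: SilvermanATAEC1994, IV.9.4]
[cite: Wuthrich2014, Lemma 20 (p. 399)] [cite: GrossLMS1991, Thm. 1.3, Prop. 3.7 (2)]. Design: no definitions.
Axioms: `propext`, `Classical.choice`, `Quot.sound`.
-/

set_option autoImplicit false

noncomputable section

open scoped Classical

open IsDedekindDomain NumberField WeierstrassCurve Literature.NumberTheory.EllipticCurves
  Literature.NumberTheory.EllipticCurves.ModularForms Literature.NumberTheory.GaloisCohomology
  Literature.NumberTheory.EllipticCurves.Rank1Residual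
  Literature.NumberTheory.EllipticCurves.Rank1Residual.Typed
  Literature.NumberTheory.EllipticCurves.Rank1Residual.X11RankOneCertificates
  Summit.BirchSwinnertonDyer.BirchSwinnertonDyer.Rank1Residual
  Summit.BirchSwinnertonDyer.BirchSwinnertonDyer.Rank1Residual.IntModel
  Summit.BirchSwinnertonDyer.BirchSwinnertonDyer.Rank1Residual.X11RankOne
  Summit.BirchSwinnertonDyer.BirchSwinnertonDyer.Rank2Observatory.Tam
  Summit.BirchSwinnertonDyer.Rank1Residual Summit.BirchSwinnertonDyer.Rank1Residual.X11b

namespace Summit.BirchSwinnertonDyer.Rank1Residual.JET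

/-! ## §1 Road F (bucket A, `p = 3`, any reduction at `3`) ⟸ named print only -/

/-- **Road F re-keyed: `bsdp_of_jetRowA3F_tam_min` with every class-free binder except {PT, F1, Gross 3.7 (2),
GZK, Kolyvagin, modularity} FED BY NAME.** Numeric front-end VERBATIM; consumer
`JET.bsdp_of_carrierNeCertificate_level_of_swapLiterature` (the `3`-adic tower from the mod-`9` witness).
CONDITIONAL on every binder; per pair. [cite: Jetchev2008, Cor. 1.5 (p. 812)]
[cite: SerreAbelianLadic1968, Ch. IV §3.4 Lemma 3 (IV-23)] [cite: Serre1972, §2.4 Prop. 15 and §5.2 (iii)] -/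
theorem bsdp_of_jetRowA3F_tam_min_of_swapLiterature (a1 a2 a3 a4 a6 : ℤ)
    (hmin : (⟨a1, a2, a3, a4, a6⟩ : WeierstrassCurve ℚ).IsGloballyMinimal)
    (ℓ₁ ℓ₂ : ℕ) (hℓ₁ : ℓ₁.Prime) (hℓ₂ : ℓ₂.Prime) (h2₁ : ℓ₁ ≠ 2) (h2₂ : ℓ₂ ≠ 2)
    (h3₁ : ℓ₁ ≠ 3) (h3₂ : ℓ₂ ≠ 3)
    (hΔ₁ : ¬ (ℓ₁ : ℤ) ∣ discOf [a1, a2, a3, a4, a6]) (hΔ₂ : ¬ (ℓ₂ : ℤ) ∣ discOf [a1, a2, a3, a4, a6])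
    {n₁ n₂ : ℕ} (hc₁ : countPoints [a1, a2, a3, a4, a6] ℓ₁ = n₁)
    (hc₂ : countPoints [a1, a2, a3, a4, a6] ℓ₂ = n₂)
    (hirr : ∀ t : ZMod 3, t ^ 2 - (((ℓ₁ : ℤ) + 1 - n₁ : ℤ) : ZMod 3) * t + ℓ₁ ≠ 0)
    (hdet₂ : (ℓ₂ : ZMod 3) = 1) (htr₂ : (((ℓ₂ : ℤ) + 1 - n₂ : ℤ) : ZMod 3) = 2) (hsq : ¬ 9 ∣ n₂)
    (ℓ₉ : ℕ) (hℓ₉ : ℓ₉.Prime) (h2₉ : ℓ₉ ≠ 2)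
    (hΔ₉ : ¬ (ℓ₉ : ℤ) ∣ (⟨a1, a2, a3, a4, a6⟩ : WeierstrassCurve ℤ).Δ)
    {n₉ : ℕ} (hc₉ : countPoints [a1, a2, a3, a4, a6] ℓ₉ = n₉)
    (hℓ9 : ℓ₉ % 9 = 2 ∨ ℓ₉ % 9 = 5)
    (ha9 : ((ℓ₉ : ℤ) + 1 - n₉) % 9 = 3 ∨ ((ℓ₉ : ℤ) + 1 - n₉) % 9 = 6)
    (q : ℕ) (T : TamLocal) (hTq : T.p = q) (hT : T.check ⟨a1, a2, a3, a4, a6⟩ = true)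
    {c : ℕ} (hvals : T.vals = [c]) {w : ℕ} (hw : w ≤ padicValNat 3 c) (hq3 : q ≠ 3)
    (hPT : ∀ (K : Type) [Field K] [NumberField K], poitouTate_selmerStructure_duality_conj K)
    (hF1 : Gross1991_heegnerPoint_sub_ratTorsion_mem_E0)
    (h372 : GrossLMS1991.prop37_2_frobeniusCongruence)
    (hGZK : rank_eq_analyticRank_of_analyticRank_le_one)
    (hKo : ∀ (N : ℕ) [NeZero N] (W : WeierstrassCurve ℚ) (K : Type) [Field K] [NumberField K], kolyvagin N W K)
    (hmod : exists_isNewformOf)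
    (W : WeierstrassCurve ℚ) (hW : W = ⟨a1, a2, a3, a4, a6⟩)
    {N : ℕ} [NeZero N] {K : Type} [Field K] [NumberField K] (hK : IsImaginaryQuadratic K)
    (hD3 : NumberField.discr K ≠ -3) (hD4 : NumberField.discr K ≠ -4)
    (hH : SatisfiesHeegnerHypothesis N K) {P : (W.baseChange K).toAffine.Point}
    (hP : IsHeegnerPoint N W K P) (hnt : ¬ IsOfFinAddOrder P) (hqN : q ∣ N)
    (hv : padicValNat 3 (AddSubgroup.zmultiples P).index ≤ w)
    (hr : W.analyticRank ≤ 1) {s : ℚ} (hs : shaAn W = (s : ℂ)) (hvs : padicValRat 3 s = 0) :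
    BSDp W 3 := by
  subst hW
  have h0 : discOf [a1, a2, a3, a4, a6] ≠ 0 := fun h ↦ hΔ₁ (by rw [h]; exact dvd_zero _)
  haveI hE : (⟨a1, a2, a3, a4, a6⟩ : WeierstrassCurve ℚ).IsElliptic :=
    X11b.isElliptic_of_discOf_ne_zero a1 a2 a3 a4 a6 h0
  haveI := hmin
  haveI : Fact (Nat.Prime 3) := ⟨by norm_num⟩
  haveI : Fact (Nat.Prime q) := ⟨hTq ▸ (TamLocal.check_common hT).1⟩
  haveI := Fact.mk hℓ₉
  have hI0 : integralModelInt (⟨a1, a2, a3, a4, a6⟩ : WeierstrassCurve ℚ) = ⟨a1, a2, a3, a4, a6⟩ :=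
    integralModelInt_eq_of_map_eq _ (map_mk_int a1 a2 a3 a4 a6)
  -- `ρ̄_{E,3}` onto from the two Frobenius witnesses (irreducible + order 3)
  have hρ : Surj (⟨a1, a2, a3, a4, a6⟩ : WeierstrassCurve ℚ) 3 :=
    Supersingular.surj_three_of_ainvs_of_irr_of_order a1 a2 a3 a4 a6 hmin ℓ₁ ℓ₂ hℓ₁ hℓ₂ h2₁ h2₂ h3₁ h3₂
      hΔ₁ hΔ₂ hc₁ hc₂ hirr hdet₂ htr₂ hsq
  -- the `3`-adic tower from the mod-`9` Frobenius witness (Serre IV-23)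
  have hn₉ : Nat.card (((⟨a1, a2, a3, a4, a6⟩ : WeierstrassCurve ℤ).map
      (Int.castRingHom (ZMod ℓ₉))).toAffine.Point) = n₉ := by
    exact_mod_cast (X11b.natCard_point_eq_countPoints a1 a2 a3 a4 a6 ℓ₉ h2₉ hΔ₉).trans hc₉
  have htower : ∀ n : ℕ, (⟨a1, a2, a3, a4, a6⟩ : WeierstrassCurve ℚ).HasSurjectiveModNGaloisRep (3 ^ n : ℕ) :=
    GaloisImage.forall_hasSurjectiveModNGaloisRep_three_pow_of_intModel_of_frobenius hI0 hρ ℓ₉ hΔ₉ hn₉ hℓ9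
      ha9
  -- the Tamagawa half in the kernel: `c_q(W/ℚ_q) = c`
  have hcq : ((⟨a1, a2, a3, a4, a6⟩ : WeierstrassCurve ℚ).baseChange ℚ_[q]).localTamagawaNumber ℤ_[q] = c :=
    Additive.IntModelTam.localTamagawaNumber_padic_eq_of_intModel_of_tamLocal hI0 q hTq hT hvals
  have hI : padicValNat 3 (AddSubgroup.zmultiples P).index ≤ padicValNat 3
      (((⟨a1, a2, a3, a4, a6⟩ : WeierstrassCurve ℚ).baseChange ℚ_[q]).localTamagawaNumber ℤ_[q]) := hcq ▸ hv.trans hw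
  exact bsdp_of_carrierNeCertificate_level_of_swapLiterature hPT hF1 h372 hGZK hKo hmod _ 3 hK hD3 hD4 hH hP hnt
    (by decide) htower q hqN hq3 hI hr hs hvs

/-! ## §2 Bucket B, `3` multiplicative (carrier `3`) ⟸ named print only -/

/-- **`bsdp_of_jetRowB3_tam_min` re-keyed to named print only**: numeric front-end VERBATIM (minimality,
`3 ∣ Δ`, `3 ∤ c₄`, two Frobenius witnesses ⇒ `ρ̄_{E,3}` onto, `TamLocal` certificate AT `3`); consumer
`JET.bsdp_of_carrierMultCertificate_level_of_surj_of_swapLiterature` (tower by the Tate line at a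
multiplicative prime). CONDITIONAL on every binder; per pair. [cite: Jetchev2008, Cor. 1.5 (p. 812)]
[cite: Serre1972, §2.4 Prop. 15 and §5.2 (iii)] [cite: Wuthrich2014, Lemma 20 (p. 399)] -/
theorem bsdp_of_jetRowB3_tam_min_of_swapLiterature (a1 a2 a3 a4 a6 : ℤ)
    (hmin : (⟨a1, a2, a3, a4, a6⟩ : WeierstrassCurve ℚ).IsGloballyMinimal)
    (h3Δ : (3 : ℤ) ∣ (⟨a1, a2, a3, a4, a6⟩ : WeierstrassCurve ℤ).Δ)
    (h3c₄ : ¬ (3 : ℤ) ∣ (⟨a1, a2, a3, a4, a6⟩ : WeierstrassCurve ℤ).c₄)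
    (ℓ₁ ℓ₂ : ℕ) (hℓ₁ : ℓ₁.Prime) (hℓ₂ : ℓ₂.Prime) (h2₁ : ℓ₁ ≠ 2) (h2₂ : ℓ₂ ≠ 2)
    (h3₁ : ℓ₁ ≠ 3) (h3₂ : ℓ₂ ≠ 3)
    (hΔ₁ : ¬ (ℓ₁ : ℤ) ∣ discOf [a1, a2, a3, a4, a6]) (hΔ₂ : ¬ (ℓ₂ : ℤ) ∣ discOf [a1, a2, a3, a4, a6])
    {n₁ n₂ : ℕ} (hc₁ : countPoints [a1, a2, a3, a4, a6] ℓ₁ = n₁)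
    (hc₂ : countPoints [a1, a2, a3, a4, a6] ℓ₂ = n₂)
    (hirr : ∀ t : ZMod 3, t ^ 2 - (((ℓ₁ : ℤ) + 1 - n₁ : ℤ) : ZMod 3) * t + ℓ₁ ≠ 0)
    (hdet₂ : (ℓ₂ : ZMod 3) = 1) (htr₂ : (((ℓ₂ : ℤ) + 1 - n₂ : ℤ) : ZMod 3) = 2) (hsq : ¬ 9 ∣ n₂)
    (T : TamLocal) (hT3 : T.p = 3) (hT : T.check ⟨a1, a2, a3, a4, a6⟩ = true)
    {c : ℕ} (hvals : T.vals = [c]) {w : ℕ} (hw : w ≤ padicValNat 3 c)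
    (hPT : ∀ (K : Type) [Field K] [NumberField K], poitouTate_selmerStructure_duality_conj K)
    (hF1 : Gross1991_heegnerPoint_sub_ratTorsion_mem_E0)
    (h372 : GrossLMS1991.prop37_2_frobeniusCongruence)
    (hGZK : rank_eq_analyticRank_of_analyticRank_le_one)
    (hKo : ∀ (N : ℕ) [NeZero N] (W : WeierstrassCurve ℚ) (K : Type) [Field K] [NumberField K], kolyvagin N W K)
    (hmod : exists_isNewformOf)
    (W : WeierstrassCurve ℚ) (hW : W = ⟨a1, a2, a3, a4, a6⟩)
    {N : ℕ} [NeZero N] {K : Type} [Field K] [NumberField K] (hK : IsImaginaryQuadratic K)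
    (hD3 : NumberField.discr K ≠ -3) (hD4 : NumberField.discr K ≠ -4)
    (hH : SatisfiesHeegnerHypothesis N K) {P : (W.baseChange K).toAffine.Point}
    (hP : IsHeegnerPoint N W K P) (hnt : ¬ IsOfFinAddOrder P)
    (hv : padicValNat 3 (AddSubgroup.zmultiples P).index ≤ w)
    (hr : W.analyticRank ≤ 1) {s : ℚ} (hs : shaAn W = (s : ℂ)) (hvs : padicValRat 3 s = 0) :
    BSDp W 3 := by
  subst hW
  have h0 : discOf [a1, a2, a3, a4, a6] ≠ 0 := fun h ↦ hΔ₁ (by rw [h]; exact dvd_zero _)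
  haveI hE : (⟨a1, a2, a3, a4, a6⟩ : WeierstrassCurve ℚ).IsElliptic :=
    X11b.isElliptic_of_discOf_ne_zero a1 a2 a3 a4 a6 h0
  haveI := hmin
  haveI : Fact (Nat.Prime 3) := ⟨by norm_num⟩
  have hI0 : integralModelInt (⟨a1, a2, a3, a4, a6⟩ : WeierstrassCurve ℚ) = ⟨a1, a2, a3, a4, a6⟩ :=
    integralModelInt_eq_of_map_eq _ (map_mk_int a1 a2 a3 a4 a6)
  have hρ : Surj (⟨a1, a2, a3, a4, a6⟩ : WeierstrassCurve ℚ) 3 :=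
    Supersingular.surj_three_of_ainvs_of_irr_of_order a1 a2 a3 a4 a6 hmin ℓ₁ ℓ₂ hℓ₁ hℓ₂ h2₁ h2₂ h3₁ h3₂
      hΔ₁ hΔ₂ hc₁ hc₂ hirr hdet₂ htr₂ hsq
  have hmult : (⟨a1, a2, a3, a4, a6⟩ : WeierstrassCurve ℚ).HasMultiplicativeReductionAtPrime 3 :=
    hasMultiplicativeReductionAtPrime_of_intModel hI0 3 h3Δ h3c₄
  -- the Tamagawa half in the kernel: `c₃(W/ℚ₃) = c`
  have hc3 : ((⟨a1, a2, a3, a4, a6⟩ : WeierstrassCurve ℚ).baseChange ℚ_[3]).localTamagawaNumber ℤ_[3] = c :=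
    Additive.IntModelTam.localTamagawaNumber_padic_eq_of_intModel_of_tamLocal hI0 3 hT3 hT hvals
  have hI : padicValNat 3 (AddSubgroup.zmultiples P).index ≤ padicValNat 3
      (((⟨a1, a2, a3, a4, a6⟩ : WeierstrassCurve ℚ).baseChange ℚ_[3]).localTamagawaNumber ℤ_[3]) := hc3 ▸ hv.trans hw
  exact bsdp_of_carrierMultCertificate_level_of_surj_of_swapLiterature hPT hF1 h372 hGZK hKo hmod _ 3 hK hD3
    hD4 hH hP hnt (by decide) hmult hρ hI hr hs hvs

/-! ## §3 Bucket B ADDITIVE at `3` (carrier `3`, Kodaira IV/IV*, K4) ⟸ named print only -/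

/-- **`bsdp_of_jetRowCarrierAdd_three_of_frobenius` re-keyed to named print only** — the bucket where the
printed Tamagawa sharpening has NO hypothesis line (`p = 3 ∣ N` ADDITIVE): numeric front-end VERBATIM
(minimality by the supported Kraus criterion, `3 ∣ Δ`, `3 ∣ c₄` ⇒ additive at `3`, `ρ̄_{E,3}` onto from an
irreducible Frobenius + a Frobenius of order `3`, the `3`-adic tower from the mod-`9` witness at `ℓ₃`);
consumer `JET.bsdp_of_carrierAddCertificate_level_of_swapLiterature`. Displayed class-free binders: {`hPT`,
`hF1`, `h372`, `hGZK`, `hKo`, `hmod`}. CONDITIONAL on every binder; per pair. [cite: Jetchev2008, Cor. 1.5 (p. 812)]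
[cite: Serre1972, §2.4 Prop. 15] [cite: SerreAbelianLadic1968, Ch. IV §3.4 Lemma 3 (IV-23)] -/
theorem bsdp_of_jetRowCarrierAdd_three_of_frobenius_of_swapLiterature
    (a1 a2 a3 a4 a6 : ℤ)
    (h0 : discOf [a1, a2, a3, a4, a6] ≠ 0) (bad : List (ℕ × ℕ × ℕ)) (hprime : ∀ t ∈ bad, t.1.Prime)
    (hsupp : (discOf [a1, a2, a3, a4, a6]).natAbs = (bad.map fun t => t.1 ^ t.2.2).prod)
    (hmin : ∀ t ∈ bad,
      (¬ (t.1 : ℤ) ^ 12 ∣ discOf [a1, a2, a3, a4, a6] ∨ ¬ (t.1 : ℤ) ^ 4 ∣ c4Of [a1, a2, a3, a4, a6]) ∨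
      (t.1 = 2 ∧ (16 : ℤ) ∣ c4Of [a1, a2, a3, a4, a6] ∧ (64 : ℤ) ∣ c6Of [a1, a2, a3, a4, a6] ∧
        ¬ (((16 : ℤ) ∣ c4Of [a1, a2, a3, a4, a6] / 16 ∧
            ((32 : ℤ) ∣ c6Of [a1, a2, a3, a4, a6] / 64 ∨ (32 : ℤ) ∣ c6Of [a1, a2, a3, a4, a6] / 64 - 8)) ∨
          (4 : ℤ) ∣ c6Of [a1, a2, a3, a4, a6] / 64 + 1)) ∨
      (t.1 = 3 ∧ (3 : ℤ) ^ 8 ∣ c6Of [a1, a2, a3, a4, a6] ∧ ¬ (3 : ℤ) ^ 9 ∣ c6Of [a1, a2, a3, a4, a6]))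
    (h3Δ : (3 : ℤ) ∣ (⟨a1, a2, a3, a4, a6⟩ : WeierstrassCurve ℤ).Δ)
    (h3c₄ : (3 : ℤ) ∣ (⟨a1, a2, a3, a4, a6⟩ : WeierstrassCurve ℤ).c₄)
    (ℓ₁ ℓ₂ ℓ₃ : ℕ) (hℓ₁ : ℓ₁.Prime) (hℓ₂ : ℓ₂.Prime) (hℓ₃ : ℓ₃.Prime)
    (h2ℓ₁ : ℓ₁ ≠ 2) (h2ℓ₂ : ℓ₂ ≠ 2) (h2ℓ₃ : ℓ₃ ≠ 2) (h3ℓ₁ : ℓ₁ ≠ 3) (h3ℓ₂ : ℓ₂ ≠ 3)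
    (hΔ₁ : ¬ (ℓ₁ : ℤ) ∣ (⟨a1, a2, a3, a4, a6⟩ : WeierstrassCurve ℤ).Δ)
    (hΔ₂ : ¬ (ℓ₂ : ℤ) ∣ (⟨a1, a2, a3, a4, a6⟩ : WeierstrassCurve ℤ).Δ)
    (hΔ₃ : ¬ (ℓ₃ : ℤ) ∣ (⟨a1, a2, a3, a4, a6⟩ : WeierstrassCurve ℤ).Δ)
    {n₁ n₂ n₃ : ℕ} (hc₁ : countPoints [a1, a2, a3, a4, a6] ℓ₁ = n₁)
    (hc₂ : countPoints [a1, a2, a3, a4, a6] ℓ₂ = n₂) (hc₃ : countPoints [a1, a2, a3, a4, a6] ℓ₃ = n₃)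
    (hi : ∀ c : ZMod 3, c ^ 2 - (((ℓ₁ : ℤ) + 1 - n₁ : ℤ) : ZMod 3) * c + ℓ₁ ≠ 0)
    (hii : (ℓ₂ : ZMod 3) = 1 ∧ (((ℓ₂ : ℤ) + 1 - n₂ : ℤ) : ZMod 3) = 2 ∧ ¬ 9 ∣ n₂)
    (hiii : (ℓ₃ % 9 = 2 ∨ ℓ₃ % 9 = 5) ∧
      (((ℓ₃ : ℤ) + 1 - n₃) % 9 = 3 ∨ ((ℓ₃ : ℤ) + 1 - n₃) % 9 = 6))
    (hPT : ∀ (K : Type) [Field K] [NumberField K], poitouTate_selmerStructure_duality_conj K)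
    (hF1 : Gross1991_heegnerPoint_sub_ratTorsion_mem_E0)
    (h372 : GrossLMS1991.prop37_2_frobeniusCongruence)
    (hGZK : rank_eq_analyticRank_of_analyticRank_le_one)
    (hKo : ∀ (N : ℕ) [NeZero N] (W : WeierstrassCurve ℚ) (K : Type) [Field K] [NumberField K], kolyvagin N W K)
    (hmod : exists_isNewformOf)
    (W : WeierstrassCurve ℚ) (hW : W = ⟨a1, a2, a3, a4, a6⟩)
    {N : ℕ} [NeZero N] {K : Type} [Field K] [NumberField K] (hK : IsImaginaryQuadratic K)
    (hD3 : NumberField.discr K ≠ -3) (hD4 : NumberField.discr K ≠ -4)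
    (hH : SatisfiesHeegnerHypothesis N K) {P : (W.baseChange K).toAffine.Point}
    (hP : IsHeegnerPoint N W K P) (hnt : ¬ IsOfFinAddOrder P)
    (hI : padicValNat 3 (AddSubgroup.zmultiples P).index ≤
      padicValNat 3 ((W.baseChange ℚ_[3]).localTamagawaNumber ℤ_[3]))
    (hr : W.analyticRank ≤ 1) {s : ℚ} (hs : shaAn W = (s : ℂ)) (hv : padicValRat 3 s = 0) :
    BSDp W 3 := by
  subst hW
  haveI hE : (⟨a1, a2, a3, a4, a6⟩ : WeierstrassCurve ℚ).IsElliptic :=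
    X11b.isElliptic_of_discOf_ne_zero a1 a2 a3 a4 a6 h0
  haveI hM : (⟨a1, a2, a3, a4, a6⟩ : WeierstrassCurve ℚ).IsGloballyMinimal :=
    X11b.isGloballyMinimal_of_krausCriterion_support a1 a2 a3 a4 a6 bad hprime hsupp hmin
  haveI := Fact.mk hℓ₁; haveI := Fact.mk hℓ₂; haveI := Fact.mk hℓ₃
  haveI : Fact (Nat.Prime 3) := ⟨by norm_num⟩
  have hI0 : integralModelInt (⟨a1, a2, a3, a4, a6⟩ : WeierstrassCurve ℚ) = ⟨a1, a2, a3, a4, a6⟩ :=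
    integralModelInt_eq_of_map_eq _ (map_mk_int a1 a2 a3 a4 a6)
  -- the three witness counts in `Nat.card` form
  have hn₁ : Nat.card (((⟨a1, a2, a3, a4, a6⟩ : WeierstrassCurve ℤ).map
      (Int.castRingHom (ZMod ℓ₁))).toAffine.Point) = n₁ := by
    exact_mod_cast (X11b.natCard_point_eq_countPoints a1 a2 a3 a4 a6 ℓ₁ h2ℓ₁ hΔ₁).trans hc₁
  have hn₂ : Nat.card (((⟨a1, a2, a3, a4, a6⟩ : WeierstrassCurve ℤ).map
      (Int.castRingHom (ZMod ℓ₂))).toAffine.Point) = n₂ := by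
    exact_mod_cast (X11b.natCard_point_eq_countPoints a1 a2 a3 a4 a6 ℓ₂ h2ℓ₂ hΔ₂).trans hc₂
  have hn₃ : Nat.card (((⟨a1, a2, a3, a4, a6⟩ : WeierstrassCurve ℤ).map
      (Int.castRingHom (ZMod ℓ₃))).toAffine.Point) = n₃ := by
    exact_mod_cast (X11b.natCard_point_eq_countPoints a1 a2 a3 a4 a6 ℓ₃ h2ℓ₃ hΔ₃).trans hc₃
  -- additive at `3`
  obtain ⟨hng, hnm⟩ := not_good_and_not_mult_of_intModel hI0 3 h3Δ h3c₄
  -- `ρ̄_{E,3}` onto: irreducible Frobenius at `ℓ₁`, Frobenius of order `3` at `ℓ₂`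
  have hsurj : (⟨a1, a2, a3, a4, a6⟩ : WeierstrassCurve ℚ).HasSurjectiveModNGaloisRep 3 :=
    GaloisImage.hasSurjectiveModNGaloisRep_of_intModel_of_irr_of_order hI0 3 ℓ₁ ℓ₂ h3ℓ₁ h3ℓ₂ hΔ₁
      hΔ₂ hn₁ hn₂ hi hii.1 hii.2.1 (by norm_num; exact hii.2.2)
  -- the mod-`9` witness at `ℓ₃`: good reduction and `a_{ℓ₃} = ℓ₃ + 1 − n₃`; the `3`-adic tower
  have hgood₃ : (⟨a1, a2, a3, a4, a6⟩ : WeierstrassCurve ℚ).HasGoodReductionAtPrime ℓ₃ :=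
    hasGoodReductionAtPrime_of_not_dvd _ ℓ₃ (by rw [minimalDiscriminantInt_eq hI0]; exact hΔ₃)
  have ha9 : (⟨a1, a2, a3, a4, a6⟩ : WeierstrassCurve ℚ).frobeniusTrace ℓ₃ % 9 = 3 ∨
      (⟨a1, a2, a3, a4, a6⟩ : WeierstrassCurve ℚ).frobeniusTrace ℓ₃ % 9 = 6 := by
    rw [frobeniusTrace_eq hI0 hn₃]; exact hiii.2
  exact bsdp_of_carrierAddCertificate_level_of_swapLiterature hPT hF1 h372 hGZK hKo hmod _ 3 hK hD3 hD4 hH hP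
    hnt (by norm_num) hng hnm
    ((⟨a1, a2, a3, a4, a6⟩ : WeierstrassCurve ℚ).forall_hasSurjectiveModNGaloisRep_three_pow_of_frobenius hsurj
      ℓ₃ hgood₃ hiii.1 ha9) hI hr hs hv

end Summit.BirchSwinnertonDyer.Rank1Residual.JET

end
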